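import Literature.AnabelianGeometry.AbsoluteAnabelian.AbsTopI.SemiAbsoluteChains
import HarnessLib

/-!
# Transport of Π-chains along an isomorphism of extensions — the constructions

[AbsTopI] Thm 4.7 (ii) p. 57 ("the isomorphism `φ` induces equivalences of categories
`Chain(Π₁) ⥲ Chain(Π₂)`"; printed proof p. 58: "the definitions of the various categories involved
are entirely group-theoretic") is proved for abc-iut-L4-t4's Π-chains (`AbsTopIChains.lean`) by
transport of structure along `φ : E ≅ F`.  This file holds the CONSTRUCTIONS: the transported chain term
(`transportTerm`: same `Πⱼ`, rigidification domain `φ(dom)`, rigidifying homomorphism `ρⱼ ∘ φ⁻¹`,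
structure map `φ_G ∘ (Πⱼ → G_E)`) with its isomorphism over `φ` (`transportTermIso`), `selfIso`
(`Π_E ≅ Π_F`), conjugation of operation homomorphisms (`conjHom`), STRICT term isomorphisms
(`ChainGroupIsoOver.IsStrict`), the `J`-subgroups of Def 4.2 (iii) (3_Π) (`Jgrp`), the restriction
`Δⱼ(L) ≃* Δⱼ(M)` (`ChainGroupIsoOver.geomJEquiv`), and the term data of the transported chain
(`transportTerms`, `transportTermsIso`), together with their basic lemmas.  The transfer of the
elementary operations ⋏ ⋎ ⊚ • and the theorem itself are in the proof companions
`ChainTransportOps.lean`, `ChainTransportCusp.lean`, `ChainTransportThm.lean`.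
[cite: MochizukiAbsTopI2012, Thm 4.7 (ii) p.57]
-/

noncomputable section

open CategoryTheory Topology
open scoped Pointwise

universe u

namespace Literature.AnabelianGeometry.AbsoluteAnabelian.AbsTopI

open Literature.AlgebraicGeometry.Frobenioids (IsSlimGroup)
open FundamentalExtension

variable {E F : FundamentalExtension.{u}} (φ : E ≅ F)

/-! ### The isomorphisms of `Π` and `G` underlying an isomorphism of extensions -/

/-- `φ` on `Π` as an isomorphism of topological groups. [cite: MochizukiAbsTopI2012, Thm 4.7 p.56] -/
def isoArith : E.arith ≃ₜ* F.arith where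
  toFun := φ.hom.arith
  invFun := φ.inv.arith
  left_inv := iso_inv_hom_arith φ
  right_inv := iso_hom_inv_arith φ
  map_mul' := map_mul φ.hom.arith
  continuous_toFun := φ.hom.arith.continuous
  continuous_invFun := φ.inv.arith.continuous

/-- `φ` on `G` as an isomorphism of topological groups. [cite: MochizukiAbsTopI2012, Thm 4.7 p.56] -/
def isoGal : E.gal ≃ₜ* F.gal where
  toFun := φ.hom.gal
  invFun := φ.inv.gal
  left_inv := iso_inv_hom_gal φ
  right_inv := iso_hom_inv_gal φ
  map_mul' := map_mul φ.hom.gal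
  continuous_toFun := φ.hom.gal.continuous
  continuous_invFun := φ.inv.gal.continuous

/-- Underlying function of `isoArith`. [cite: MochizukiAbsTopI2012, Thm 4.7 p.56] -/
@[simp] theorem isoArith_apply (x : E.arith) : isoArith φ x = φ.hom.arith x := rfl

/-- Underlying function of `isoGal`. [cite: MochizukiAbsTopI2012, Thm 4.7 p.56] -/
@[simp] theorem isoGal_apply (g : E.gal) : isoGal φ g = φ.hom.gal g := rfl

/-! ### Transport of one chain term -/

/-- Pull-back of a rigidification domain: `φ(D) → D`, `y ↦ φ⁻¹ y`.
[cite: MochizukiAbsTopI2012, Def 4.2 (iii) p.49] -/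
def domPullback (D : Subgroup E.arith) :
    (D.map φ.hom.arith.toMonoidHom : Subgroup F.arith) →ₜ* D where
  toFun y := ⟨φ.inv.arith y, by
    obtain ⟨x, hx, hxy⟩ := y.2
    rw [← hxy]
    change φ.inv.arith (φ.hom.arith x) ∈ D
    rw [iso_inv_hom_arith]
    exact hx⟩
  map_one' := Subtype.ext (by
    change φ.inv.arith ((1 : (D.map φ.hom.arith.toMonoidHom : Subgroup F.arith)) : F.arith) = 1
    simp)
  map_mul' a b := Subtype.ext (by
    change φ.inv.arith ((a : F.arith) * (b : F.arith)) = φ.inv.arith a * φ.inv.arith b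
    exact map_mul _ _ _)
  continuous_toFun := by
    apply Continuous.subtype_mk
    exact φ.inv.arith.continuous.comp continuous_subtype_val

/-- `domPullback` is surjective (`x = φ⁻¹(φ x)`). [cite: MochizukiAbsTopI2012, Def 4.2 (iii) p.49] -/
theorem domPullback_surjective (D : Subgroup E.arith) : Function.Surjective (domPullback φ D) := by
  intro x
  refine ⟨⟨φ.hom.arith x, x, x.2, rfl⟩, Subtype.ext ?_⟩
  change φ.inv.arith (φ.hom.arith x) = x
  exact iso_inv_hom_arith φ x

/-- The kernel of `φ_G ∘ p` is the kernel of `p` (`φ_G` is injective).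
[cite: MochizukiAbsTopI2012, Def 4.2 (iii) p.49] -/
theorem ker_gal_comp {H : Type u} [Group H] [TopologicalSpace H] (p : H →ₜ* E.gal) :
    (φ.hom.gal.comp p).toMonoidHom.ker = p.toMonoidHom.ker := by
  ext x
  rw [MonoidHom.mem_ker, MonoidHom.mem_ker]
  change φ.hom.gal (p x) = 1 ↔ p x = 1
  constructor
  · intro h
    have h' := congrArg φ.inv.gal h
    rwa [iso_inv_hom_gal, map_one] at h'
  · intro h
    rw [h, map_one]

/-- TRANSPORT of a chain term `Πⱼ` of a `Π_E`-chain along `φ : E ≅ F` ([AbsTopI] Def 4.2 (iii),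
proof of Thm 4.7 (ii) p. 58): the same profinite group `Πⱼ`, with rigidification domain `φ(dom)`,
rigidifying homomorphism `ρⱼ ∘ φ⁻¹`, and structure map `φ_G ∘ (Πⱼ → G_E)`.
[cite: MochizukiAbsTopI2012, Thm 4.7 (ii) p.57] -/
def transportTerm (L : E.ChainGroup) : F.ChainGroup where
  grp := L.grp
  slim := L.slim
  dom := L.dom.map φ.hom.arith.toMonoidHom
  isOpen_dom := isOpen_map_arith_of_iso φ L.isOpen_dom
  rig := L.rig.comp (domPullback φ L.dom)
  isOpen_range_rig := by
    have h : Set.range (L.rig.comp (domPullback φ L.dom)) = Set.range L.rig := by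
      change Set.range (L.rig ∘ domPullback φ L.dom) = _
      exact (domPullback_surjective φ L.dom).range_comp L.rig
    rw [h]
    exact L.isOpen_range_rig
  proj := φ.hom.gal.comp L.proj
  isOpen_range_proj := by
    have h : Set.range (φ.hom.gal.comp L.proj) = (isoGal φ).toHomeomorph '' Set.range L.proj := by
      rw [← Set.range_comp]
      rfl
    rw [h]
    exact (isoGal φ).toHomeomorph.isOpenMap _ L.isOpen_range_proj
  comm := fun y => by
    change φ.hom.gal (L.proj (L.rig (domPullback φ L.dom y))) = F.aug y
    rw [L.comm, ← φ.hom.comm]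
    change F.aug (φ.hom.arith (φ.inv.arith y)) = F.aug y
    rw [iso_hom_inv_arith]
  slim_ker := by
    rw [ker_gal_comp]
    exact L.slim_ker
  ker_ne_bot := by
    rw [ker_gal_comp]
    exact L.ker_ne_bot

/-- The transported term is isomorphic to the original one over `φ` (by the identity of `Πⱼ`).
[cite: MochizukiAbsTopI2012, Thm 4.7 (ii) p.57] -/
def transportTermIso (L : E.ChainGroup) : ChainGroupIsoOver φ L (transportTerm φ L) where
  iso := ContinuousMulEquiv.refl _
  proj_comm := fun _ => rfl
  rig_comm := ⟨L.dom, L.isOpen_dom, le_rfl, le_rfl, fun x => by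
    change L.rig x = L.rig (domPullback φ L.dom ⟨φ.hom.arith x, _⟩)
    congr 1
    apply Subtype.ext
    change (x : E.arith) = φ.inv.arith (φ.hom.arith x)
    rw [iso_inv_hom_arith]⟩

/-- The initial terms correspond: `Π_E ≅ Π_F` over `φ` (by `φ` itself).
[cite: MochizukiAbsTopI2012, Thm 4.7 (ii) p.57] -/
def selfIso (hP₁ : IsSlimGroup E.arith) (hΔ₁ : IsSlimGroup E.geom) (hne₁ : E.geom ≠ ⊥)
    (hP₂ : IsSlimGroup F.arith) (hΔ₂ : IsSlimGroup F.geom) (hne₂ : F.geom ≠ ⊥) :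
    ChainGroupIsoOver φ (ChainGroup.self hP₁ hΔ₁ hne₁) (ChainGroup.self hP₂ hΔ₂ hne₂) where
  iso := isoArith φ
  proj_comm := fun x => (φ.hom.comm x).symm ▸ rfl
  rig_comm := ⟨⊤, isOpen_univ, le_rfl, le_top, fun _ => rfl⟩

/-! ### Conjugation of operation homomorphisms; compatibility with rigidifications -/

variable {φ}

/-- Conjugating an operation homomorphism by term isomorphisms: `I' ∘ ψ ∘ I⁻¹`.
[cite: MochizukiAbsTopI2012, Thm 4.7 (ii) p.57] -/
def conjHom {L L' : E.ChainGroup} {M M' : F.ChainGroup} (I : ChainGroupIsoOver φ L M)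
    (I' : ChainGroupIsoOver φ L' M') (ψ : L.grp →ₜ* L'.grp) : M.grp →ₜ* M'.grp where
  toMonoidHom := I'.iso.toMonoidHom.comp (ψ.toMonoidHom.comp I.iso.symm.toMonoidHom)
  continuous_toFun := I'.iso.continuous.comp (ψ.continuous.comp I.iso.symm.continuous)

/-- Underlying function of `conjHom`. [cite: MochizukiAbsTopI2012, Thm 4.7 (ii) p.57] -/
@[simp] theorem conjHom_apply {L L' : E.ChainGroup} {M M' : F.ChainGroup}
    (I : ChainGroupIsoOver φ L M) (I' : ChainGroupIsoOver φ L' M') (ψ : L.grp →ₜ* L'.grp)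
    (y : M.grp) : conjHom I I' ψ y = I'.iso (ψ (I.iso.symm y)) := rfl

/-- Compatibility with rigidifying homomorphisms is preserved under term isomorphisms over `φ`.
[cite: MochizukiAbsTopI2012, Thm 4.7 (ii) p.57] -/
theorem rigCompat_transfer {L L' : E.ChainGroup} {M M' : F.ChainGroup}
    (I : ChainGroupIsoOver φ L M) (I' : ChainGroupIsoOver φ L' M') (ψ : L.grp →ₜ* L'.grp)
    (h : ChainGroup.RigCompat L L' ψ) : ChainGroup.RigCompat M M' (conjHom I I' ψ) := by
  obtain ⟨U, hUo, hU, hU', hψ⟩ := h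
  obtain ⟨V, hVo, hV₁, hV₂, hI⟩ := I.rig_comm
  obtain ⟨V', hV'o, hV'₁, hV'₂, hI'⟩ := I'.rig_comm
  let W : Subgroup E.arith := U ⊓ (V ⊓ V')
  have hWo : IsOpen (W : Set E.arith) := by
    change IsOpen ((U : Set E.arith) ∩ ((V : Set E.arith) ∩ (V' : Set E.arith)))
    exact hUo.inter (hVo.inter hV'o)
  refine ⟨W.map φ.hom.arith.toMonoidHom, isOpen_map_arith_of_iso φ hWo, ?_, ?_, ?_⟩
  · exact (Subgroup.map_mono (inf_le_right.trans inf_le_left)).trans hV₂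
  · exact (Subgroup.map_mono (inf_le_right.trans inf_le_right)).trans hV'₂
  · rintro ⟨y, hy⟩
    obtain ⟨x, hxW, rfl⟩ := hy
    have hxU : x ∈ U := hxW.1
    have hxV : x ∈ V := hxW.2.1
    have hxV' : x ∈ V' := hxW.2.2
    have e1 : M.rig ⟨φ.hom.arith x, hV₂ ⟨x, hxV, rfl⟩⟩ = I.iso (L.rig ⟨x, hV₁ hxV⟩) :=
      (hI ⟨x, hxV⟩).symm
    have e2 : ψ (L.rig ⟨x, hU hxU⟩) = L'.rig ⟨x, hU' hxU⟩ := hψ ⟨x, hxU⟩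
    have e3 : I'.iso (L'.rig ⟨x, hV'₁ hxV'⟩) = M'.rig ⟨φ.hom.arith x, hV'₂ ⟨x, hxV', rfl⟩⟩ :=
      hI' ⟨x, hxV'⟩
    change I'.iso (ψ (I.iso.symm (M.rig ⟨φ.hom.arith x, _⟩))) = M'.rig ⟨φ.hom.arith x, _⟩
    rw [e1, ContinuousMulEquiv.symm_apply_apply, e2]
    exact e3

/-! ### `Δⱼ` under term isomorphisms; kernels of conjugated homomorphisms -/

/-- A term isomorphism over `φ` carries `Δⱼ = Ker(Πⱼ → G)` onto `Δ` of the target term.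
[cite: MochizukiAbsTopI2012, Thm 4.7 (ii) p.57] -/
theorem ChainGroupIsoOver.map_geomJ {L : E.ChainGroup} {M : F.ChainGroup}
    (I : ChainGroupIsoOver φ L M) : L.geomJ.map I.iso.toMonoidHom = M.geomJ := by
  ext y
  constructor
  · rintro ⟨x, hx, rfl⟩
    have hx' : L.proj x = 1 := hx
    change M.proj (I.iso x) = 1
    rw [I.proj_comm, hx', map_one]
  · intro hy
    have hy' : M.proj y = 1 := hy
    refine ⟨I.iso.symm y, ?_, I.iso.apply_symm_apply y⟩
    change L.proj (I.iso.symm y) = 1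
    have h := I.proj_comm (I.iso.symm y)
    rw [I.iso.apply_symm_apply, hy'] at h
    have h2 := congrArg φ.inv.gal h
    rw [map_one, iso_inv_hom_gal] at h2
    exact h2.symm

/-- The kernel of a conjugated operation homomorphism is the image of the kernel.
[cite: MochizukiAbsTopI2012, Thm 4.7 (ii) p.57] -/
theorem ker_conjHom {L L' : E.ChainGroup} {M M' : F.ChainGroup} (I : ChainGroupIsoOver φ L M)
    (I' : ChainGroupIsoOver φ L' M') (ψ : L.grp →ₜ* L'.grp) :
    (conjHom I I' ψ).toMonoidHom.ker = ψ.toMonoidHom.ker.map I.iso.toMonoidHom := by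
  ext y
  rw [MonoidHom.mem_ker]
  change I'.iso (ψ (I.iso.symm y)) = 1 ↔ _
  rw [map_eq_one_iff I'.iso I'.iso.injective]
  constructor
  · intro h
    exact ⟨I.iso.symm y, h, I.iso.apply_symm_apply y⟩
  · rintro ⟨x, hx, rfl⟩
    have hx' : ψ x = 1 := hx
    change ψ (I.iso.symm (I.iso x)) = 1
    rw [I.iso.symm_apply_apply, hx']

/-- "Topologically normally generated by `A`" is transported along term isomorphisms: the image of
`closure (normalClosure A)` under a topological group isomorphism is `closure (normalClosure (image
of A))`. [cite: MochizukiAbsTopI2012, Thm 4.7 (ii) p.57] -/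
theorem kerTopNormallyGeneratedBy_transfer {L L' : E.ChainGroup} {M M' : F.ChainGroup}
    (I : ChainGroupIsoOver φ L M) (I' : ChainGroupIsoOver φ L' M') (ψ : L.grp →ₜ* L'.grp)
    (A : Subgroup L.grp) (h : ChainGroup.KerTopNormallyGeneratedBy ψ A) :
    ChainGroup.KerTopNormallyGeneratedBy (conjHom I I' ψ) (A.map I.iso.toMonoidHom) := by
  unfold ChainGroup.KerTopNormallyGeneratedBy at h ⊢
  rw [ker_conjHom, h]
  apply SetLike.coe_injective
  rw [Subgroup.coe_map, Subgroup.topologicalClosure_coe, Subgroup.topologicalClosure_coe,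
    Subgroup.coe_map]
  change I.iso.toHomeomorph '' _ = _
  rw [I.iso.toHomeomorph.image_closure]
  congr 1
  change ⇑I.iso.toMonoidHom '' (Subgroup.normalClosure (A : Set L.grp) : Set L.grp) = _
  rw [← Subgroup.coe_map, Subgroup.map_normalClosure _ _ I.iso.surjective]

/-! ### Strict term isomorphisms -/

/-- A term isomorphism over `φ` is *strict* if the target's rigidification domain is exactly
`φ(dom)` and the rigidifying homomorphisms agree on ALL of `dom` (not only on an open subgroup).
The canonical transport (`transportTermIso`) and `selfIso` are strict; strictness makes the
`J`-subgroups of [AbsTopI] Def 4.2 (iii) (3_Π) correspond exactly. [cite: MochizukiAbsTopI2012, Def 4.2 (iii) p.49] -/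
structure ChainGroupIsoOver.IsStrict {L : E.ChainGroup} {M : F.ChainGroup}
    (I : ChainGroupIsoOver φ L M) : Prop where
  /-- `dom_M = φ(dom_L)` -/
  dom_eq : M.dom = L.dom.map φ.hom.arith.toMonoidHom
  /-- `I ∘ ρ_L = ρ_M ∘ φ` on all of `dom_L` -/
  rig_eq : ∀ (x : L.dom) (hx : φ.hom.arith x ∈ M.dom), I.iso (L.rig x) = M.rig ⟨φ.hom.arith x, hx⟩

/-! ### The `J`-subgroups of (3_Π) under strict isomorphisms -/

/-- The subgroup "image via `ρⱼ` of the inverse image in `Π̃` of [a conjugate of] the decomposition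
group in `Δ` of a cusp" of [AbsTopI] Def 4.2 (iii) (3_Π), as it appears (as a `let`) in
`ChainGroup.cuspidalDecompGroups`. [cite: MochizukiAbsTopI2012, Def 4.2 (iii) p.49] -/
def Jgrp (L : E.ChainGroup) (D : Subgroup E.arith) : Subgroup L.grp :=
  ((D ⊓ E.geom).subgroupOf L.dom).map L.rig.toMonoidHom

/-- t4's `cuspidalDecompGroups` in terms of `Jgrp`: `D ∈ L.cuspidalDecompGroups C` iff for some cusp
`x` and `g ∈ Π`, `J := Jgrp L (g D_x g⁻¹) ≠ 1` and `D = Comm_{Δⱼ}(J ∩ Δⱼ)`.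
[cite: MochizukiAbsTopI2012, Def 4.2 (iii) p.49] -/
theorem mem_cuspidalDecompGroups_iff (L : E.ChainGroup) (C : CuspidalData E) (D : Subgroup L.grp) :
    D ∈ L.cuspidalDecompGroups C ↔ ∃ (x : C.Cusp) (g : E.arith),
      Jgrp L (MulAut.conj g • C.Dcusp x) ≠ ⊥ ∧
        D = (Subgroup.Commensurable.commensurator
          ((Jgrp L (MulAut.conj g • C.Dcusp x)).subgroupOf L.geomJ)).map L.geomJ.subtype :=
  Iff.rfl


namespace ChainGroupIsoOver

variable {L : E.ChainGroup} {M : F.ChainGroup} (I : ChainGroupIsoOver φ L M)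

/-- The restriction `Δⱼ(L) ≃* Δⱼ(M)` of a term isomorphism. [cite: MochizukiAbsTopI2012, Thm 4.7 (ii) p.57] -/
def geomJEquiv : L.geomJ ≃* M.geomJ :=
  (I.iso.toMulEquiv.subgroupMap L.geomJ).trans (MulEquiv.subgroupCongr I.map_geomJ)

/-- Underlying function of `geomJEquiv`. [cite: MochizukiAbsTopI2012, Thm 4.7 (ii) p.57] -/
@[simp] theorem coe_geomJEquiv (w : L.geomJ) : ((I.geomJEquiv w : M.geomJ) : M.grp) = I.iso w := rfl

/-- Underlying function of `geomJEquiv.symm`. [cite: MochizukiAbsTopI2012, Thm 4.7 (ii) p.57] -/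
theorem coe_geomJEquiv_symm (z : M.geomJ) : ((I.geomJEquiv.symm z : L.geomJ) : L.grp) = I.iso.symm z := by
  apply I.iso.injective
  rw [ContinuousMulEquiv.apply_symm_apply]
  exact congrArg (fun w : M.geomJ => (w : M.grp)) (I.geomJEquiv.apply_symm_apply z)

/-- `geomJEquiv` is continuous (it is a restriction of `I`). [cite: MochizukiAbsTopI2012, Thm 4.7 (ii) p.57] -/
theorem continuous_geomJEquiv : Continuous I.geomJEquiv :=
  Continuous.subtype_mk (I.iso.continuous.comp continuous_subtype_val) _

/-- `geomJEquiv.symm` is continuous. [cite: MochizukiAbsTopI2012, Thm 4.7 (ii) p.57] -/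
theorem continuous_geomJEquiv_symm : Continuous I.geomJEquiv.symm := by
  apply continuous_induced_rng.mpr
  have h : (fun z : M.geomJ => ((I.geomJEquiv.symm z : L.geomJ) : L.grp)) =
      fun z : M.geomJ => I.iso.symm (z : M.grp) := funext I.coe_geomJEquiv_symm
  change Continuous (fun z : M.geomJ => ((I.geomJEquiv.symm z : L.geomJ) : L.grp))
  rw [h]
  exact I.iso.symm.continuous.comp continuous_subtype_val

end ChainGroupIsoOver

/-! ### Term data of the transported chain -/

section Transport

variable (φ)

/-- Binder package for the target side of a transport: cuspidal data on `F` and the slimness inputs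
of `PiChain` (Def 4.2 (iii) (0_Π)–(2_Π)). [cite: MochizukiAbsTopI2012, Def 4.2 (iii) p.49] -/
structure TargetData (F : FundamentalExtension.{u}) : Type (u + 1) where
  /-- cuspidal data on `F` -/
  C : CuspidalData F
  /-- `Π_F` slim -/
  hP : IsSlimGroup F.arith
  /-- `Δ_F` slim -/
  hΔ : IsSlimGroup F.geom
  /-- `Δ_F ≠ 1` -/
  hne : F.geom ≠ ⊥

variable {C₁ : CuspidalData E} {hP₁ : IsSlimGroup E.arith} {hΔ₁ : IsSlimGroup E.geom}
  {hne₁ : E.geom ≠ ⊥}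

/-- The terms of the transported chain: `Π_F` itself at index `0`, the transported terms elsewhere.
[cite: MochizukiAbsTopI2012, Thm 4.7 (ii) p.57] -/
def transportTerms (T : TargetData F) (c : E.PiChain C₁ hP₁ hΔ₁ hne₁) :
    Fin (c.len + 1) → F.ChainGroup :=
  Fin.cases (ChainGroup.self T.hP T.hΔ T.hne) fun j => transportTerm φ (c.term j.succ)

/-- `selfIso` re-indexed along an equation `L = Π_E` (used at index `0` of a chain, where
`c.term 0 = Π` holds propositionally, `PiChain.term_zero`). [cite: MochizukiAbsTopI2012, Thm 4.7 (ii) p.57] -/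
def isoOfEqSelf {L : E.ChainGroup} (e : L = ChainGroup.self hP₁ hΔ₁ hne₁) (T : TargetData F) :
    ChainGroupIsoOver φ L (ChainGroup.self T.hP T.hΔ T.hne) := by
  subst e
  exact selfIso φ hP₁ hΔ₁ hne₁ T.hP T.hΔ T.hne

/-- The term isomorphisms over `φ` between a chain and its transport (`φ` itself at index `0`, the
identity elsewhere). [cite: MochizukiAbsTopI2012, Thm 4.7 (ii) p.57] -/
def transportTermsIso (T : TargetData F) (c : E.PiChain C₁ hP₁ hΔ₁ hne₁) :
    ∀ j : Fin (c.len + 1), ChainGroupIsoOver φ (c.term j) (transportTerms φ T c j) :=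
  Fin.cases (isoOfEqSelf φ c.term_zero T) fun j => transportTermIso φ (c.term j.succ)

end Transport

end Literature.AnabelianGeometry.AbsoluteAnabelian.AbsTopI
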